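import Summits.SmoothPoincare4.SmoothPoincare4.Theses.EntropyRung
import Summits.SmoothPoincare4.SmoothPoincare4.Theorems.SubcylindricalExistence.Negative.Logic
import Summits.SmoothPoincare4.SmoothPoincare4.Theorems.EntropyRungSubcylindricalExistenceConeCoreReduction
import HarnessLib

/-!
# The transfer stub of line `fat-conical-core-avr-logsobolev` is SPC4-hard given the rung and BKT
# (crux `EntropyRung.SubcylindricalExistence`, stmt-SmoothPoincare4-10871; leads c4/c5; negative side)

Reshape R-c4 of the line `fat-conical-core-avr-logsobolev` reduces the crux ENT to its transfer stub T
`stub_coneCoreExistence` (every closed smooth homotopy 4-sphere carries a metric Euclidean in the atlas chart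
at `p`, a cone factor `Λ`, and a complete `Ric ≥ 0` core `(P, h) ≅ ({p}ᶜ, Λ²g)` of AVR `c³ > Θ(S³×ℝ)`) and the
Literature named fact `sharpLogSobolevAVR_four` (Balogh–Kristály–Tripaldi 2024, Thm 1.1): `BKT → T → ENT` is
the landed `Summit.SmoothPoincare4.SmoothPoincare4.Theorems.helper_subcylindricalExistence_of_coneCore`
(p132897). Composing with the route's deciding theorem `closes : SubcylindricalRecognition → ENT → SPC4`
gives the conditional results recorded here: given the rung and BKT, T proves SPC4
(`spc4_of_coneCoreExistence`), and an exotic 4-sphere refutes T (`not_coneCoreExistence_of_not_spc4`).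
So T carries the full difficulty of the summit along this route — crux-sized (its `S⁴` instance, `c = 1`,
flat core `ℝ⁴`, is `helper_coneCoreExistence_sphereFour`). Pure logic over landed theorems; nothing
asserted unconditionally.
-/

noncomputable section

-- the namespace of the crux's negative side repeats a component of the route namespace
set_option linter.dupNamespace false

open scoped Manifold ContDiff Topology ENNReal NNReal RealInnerProductSpace ContinuousMap
open Set Filter Function MeasureTheory
open Literature.Geometry.Lorentzian Literature.Geometry.Riemannian
open Summit.SmoothPoincare4.SmoothPoincare4.Theses.EntropyRung

namespace Summit.SmoothPoincare4.Cruxes.SubcylindricalExistence.Negative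

/-- **T ⇒ SPC4 given the rung and BKT**: cone-core existence (the transfer stub of line
`fat-conical-core-avr-logsobolev`, reshape R-c4) implies the smooth 4-dimensional Poincaré conjecture as
soon as `SubcylindricalRecognition` and the sharp AVR log-Sobolev inequality `sharpLogSobolevAVR_four` hold —
`closes` after the landed reduction `helper_subcylindricalExistence_of_coneCore`. [folklore] -/
theorem spc4_of_coneCoreExistence (hRung : SubcylindricalRecognition)
    (hBKT : Literature.Geometry.Riemannian.sharpLogSobolevAVR_four)
    (hT :
      ∀ (M : Type) [TopologicalSpace M] [T2Space M] [SecondCountableTopology M] [ChartedSpace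
        (EuclideanSpace ℝ (Fin 4)) M] [IsManifold (𝓡 4) ∞ M] [CompactSpace M] [T3Space M]
        [MeasurableSpace M] [BorelSpace M], M ≃ₕ Metric.sphere (0 : EuclideanSpace ℝ (Fin 5)) 1 → ∃
        g : PseudoRiemannianMetric (𝓡 4) ∞ (EuclideanSpace ℝ (Fin 4)) (TangentSpace (𝓡 4) : M → Type
        _), ∃ _ : g.HasLeviCivita, ∃ _ : g.IsRiemannian, ∃ (p : M) (r : ℝ) (Λ : M → ℝ) (c : ℝ) (P :
        Type) (_ : TopologicalSpace P) (_ : T2Space P) (_ : SecondCountableTopology P) (_ :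
        ChartedSpace (EuclideanSpace ℝ (Fin 4)) P) (_ : IsManifold (𝓡 4) ∞ P) (_ : ConnectedSpace P)
        (_ : NoncompactSpace P) (_ : T3Space P) (_ : MeasurableSpace P) (_ : BorelSpace P) (h :
        PseudoRiemannianMetric (𝓡 4) ∞ (EuclideanSpace ℝ (Fin 4)) (TangentSpace (𝓡 4) : P → Type _))
        (_ : h.HasLeviCivita) (hh : h.IsRiemannian) (ι : P → M) (σ : M → P), (Metric.closedBall
        (extChartAt (𝓡 4) p p) r ⊆ (extChartAt (𝓡 4) p).target ∧ ∀ y ∈ Metric.closedBall (extChartAt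
        (𝓡 4) p p) r, ∀ X W : EuclideanSpace ℝ (Fin 4), g.val ((extChartAt (𝓡 4) p).symm y) (mfderiv
        𝓘(ℝ, EuclideanSpace ℝ (Fin 4)) (𝓡 4) (extChartAt (𝓡 4) p).symm y X) (mfderiv 𝓘(ℝ,
        EuclideanSpace ℝ (Fin 4)) (𝓡 4) (extChartAt (𝓡 4) p).symm y W) = ⟪X, W⟫) ∧ (ContMDiffOn (𝓡
        4) 𝓘(ℝ, ℝ) ∞ Λ {p}ᶜ ∧ (∀ x, x ≠ p → 0 < Λ x) ∧ ∀ y ∈ Metric.closedBall (extChartAt (𝓡 4) p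
        p) r, y ≠ extChartAt (𝓡 4) p p → Λ ((extChartAt (𝓡 4) p).symm y) = c * ‖y - extChartAt (𝓡 4)
        p p‖ ^ (-(c + 1))) ∧ (ContMDiff (𝓡 4) (𝓡 4) ∞ ι ∧ Injective ι ∧ (∀ q : P, Injective (mfderiv
        (𝓡 4) (𝓡 4) ι q)) ∧ range ι = {p}ᶜ ∧ ContMDiffOn (𝓡 4) (𝓡 4) ∞ σ {p}ᶜ ∧ (∀ q : P, σ (ι q) =
        q) ∧ (∀ x : M, x ≠ p → ι (σ x) = x) ∧ ∀ (q : P) (v w : TangentSpace (𝓡 4) q), h.val q v w =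
        Λ (ι q) ^ 2 * g.val (ι q) (mfderiv (𝓡 4) (𝓡 4) ι q v) (mfderiv (𝓡 4) (𝓡 4) ι q w)) ∧ ((∀ (x
        : P) (r : NNReal), IsCompact {y : P | h.edist hh x y ≤ r}) ∧ (∀ (x : P) (X : TangentSpace (𝓡
        4) x), 0 ≤ h.ricci x X X) ∧ ∀ x : P, Tendsto (fun r : ℝ ↦ ((riemannianMeasure
        (h.toContMDiffRiemannianMetric hh)) {y : P | h.edist hh x y ≤ ENNReal.ofReal r}).toReal /
        (Real.pi ^ 2 / 2 * r ^ 4)) atTop (𝓝 (c ^ 3))) ∧ (0 < r ∧ 0 < c ∧ c ≤ 1) ∧ 2 * Real.sqrt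
        Real.pi * Real.exp (-(3 : ℝ) / 2) < c ^ 3) :
    _root_.SmoothPoincare4 :=
  closes hRung
    (_root_.Summit.SmoothPoincare4.SmoothPoincare4.Theorems.helper_subcylindricalExistence_of_coneCore hBKT hT)

/-- **¬SPC4 ⇒ ¬T given the rung and BKT**: an exotic 4-sphere kills the transfer stub of line
`fat-conical-core-avr-logsobolev` once `SubcylindricalRecognition` and `sharpLogSobolevAVR_four` hold.
[folklore] -/
theorem not_coneCoreExistence_of_not_spc4 :
    Summit.SmoothPoincare4.SmoothPoincare4.Theses.EntropyRung.SubcylindricalRecognition →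
      Literature.Geometry.Riemannian.sharpLogSobolevAVR_four → ¬ _root_.SmoothPoincare4 → ¬ (∀ (M :
      Type) [TopologicalSpace M] [T2Space M] [SecondCountableTopology M] [ChartedSpace
      (EuclideanSpace ℝ (Fin 4)) M] [IsManifold (𝓡 4) ∞ M] [CompactSpace M] [T3Space M]
      [MeasurableSpace M] [BorelSpace M], M ≃ₕ Metric.sphere (0 : EuclideanSpace ℝ (Fin 5)) 1 → ∃ g
      : PseudoRiemannianMetric (𝓡 4) ∞ (EuclideanSpace ℝ (Fin 4)) (TangentSpace (𝓡 4) : M → Type _),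
      ∃ _ : g.HasLeviCivita, ∃ _ : g.IsRiemannian, ∃ (p : M) (r : ℝ) (Λ : M → ℝ) (c : ℝ) (P : Type)
      (_ : TopologicalSpace P) (_ : T2Space P) (_ : SecondCountableTopology P) (_ : ChartedSpace
      (EuclideanSpace ℝ (Fin 4)) P) (_ : IsManifold (𝓡 4) ∞ P) (_ : ConnectedSpace P) (_ :
      NoncompactSpace P) (_ : T3Space P) (_ : MeasurableSpace P) (_ : BorelSpace P) (h :
      PseudoRiemannianMetric (𝓡 4) ∞ (EuclideanSpace ℝ (Fin 4)) (TangentSpace (𝓡 4) : P → Type _))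
      (_ : h.HasLeviCivita) (hh : h.IsRiemannian) (ι : P → M) (σ : M → P), (Metric.closedBall
      (extChartAt (𝓡 4) p p) r ⊆ (extChartAt (𝓡 4) p).target ∧ ∀ y ∈ Metric.closedBall (extChartAt
      (𝓡 4) p p) r, ∀ X W : EuclideanSpace ℝ (Fin 4), g.val ((extChartAt (𝓡 4) p).symm y) (mfderiv
      𝓘(ℝ, EuclideanSpace ℝ (Fin 4)) (𝓡 4) (extChartAt (𝓡 4) p).symm y X) (mfderiv 𝓘(ℝ,
      EuclideanSpace ℝ (Fin 4)) (𝓡 4) (extChartAt (𝓡 4) p).symm y W) = ⟪X, W⟫) ∧ (ContMDiffOn (𝓡 4)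
      𝓘(ℝ, ℝ) ∞ Λ {p}ᶜ ∧ (∀ x, x ≠ p → 0 < Λ x) ∧ ∀ y ∈ Metric.closedBall (extChartAt (𝓡 4) p p) r,
      y ≠ extChartAt (𝓡 4) p p → Λ ((extChartAt (𝓡 4) p).symm y) = c * ‖y - extChartAt (𝓡 4) p p‖ ^
      (-(c + 1))) ∧ (ContMDiff (𝓡 4) (𝓡 4) ∞ ι ∧ Injective ι ∧ (∀ q : P, Injective (mfderiv (𝓡 4) (𝓡
      4) ι q)) ∧ range ι = {p}ᶜ ∧ ContMDiffOn (𝓡 4) (𝓡 4) ∞ σ {p}ᶜ ∧ (∀ q : P, σ (ι q) = q) ∧ (∀ x :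
      M, x ≠ p → ι (σ x) = x) ∧ ∀ (q : P) (v w : TangentSpace (𝓡 4) q), h.val q v w = Λ (ι q) ^ 2 *
      g.val (ι q) (mfderiv (𝓡 4) (𝓡 4) ι q v) (mfderiv (𝓡 4) (𝓡 4) ι q w)) ∧ ((∀ (x : P) (r :
      NNReal), IsCompact {y : P | h.edist hh x y ≤ r}) ∧ (∀ (x : P) (X : TangentSpace (𝓡 4) x), 0 ≤
      h.ricci x X X) ∧ ∀ x : P, Tendsto (fun r : ℝ ↦ ((riemannianMeasure
      (h.toContMDiffRiemannianMetric hh)) {y : P | h.edist hh x y ≤ ENNReal.ofReal r}).toReal /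
      (Real.pi ^ 2 / 2 * r ^ 4)) atTop (𝓝 (c ^ 3))) ∧ (0 < r ∧ 0 < c ∧ c ≤ 1) ∧ 2 * Real.sqrt
      Real.pi * Real.exp (-(3 : ℝ) / 2) < c ^ 3) :=
  fun hRung hBKT hns hT ↦ hns (spc4_of_coneCoreExistence hRung hBKT hT)

end Summit.SmoothPoincare4.Cruxes.SubcylindricalExistence.Negative

end
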